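import Literature.NumberTheory.Automorphic.CDTTheorem722
import Literature.NumberTheory.Automorphic.CDTTheorem712
import Literature.NumberTheory.Automorphic.BCDTModularity
import Literature.NumberTheory.Automorphic.BCDTModularityModPProofs
import Literature.NumberTheory.Automorphic.HeckeAlgebraOfTypeSigma
import Literature.NumberTheory.EllipticCurves.FramedTateGaloisRep
import Literature.NumberTheory.EllipticCurves.FrobeniusTraceBaseChange
import Literature.NumberTheory.EllipticCurves.FrobeniusTateModuleProofs
import Literature.NumberTheory.EllipticCurves.TateModuleFreeProofs
import Literature.NumberTheory.EllipticCurves.TateModuleFinrankProofs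
import Literature.NumberTheory.EllipticCurves.NeronOggShafarevichProofs
import Literature.NumberTheory.EllipticCurves.IsogenyFrobeniusTraceProofs
import Literature.NumberTheory.EllipticCurves.ModularityVersionApProofs
import Literature.NumberTheory.GaloisRepresentations.FramedRepBaseChange
import Literature.NumberTheory.GaloisRepresentations.ResidualGaloisRep
import Literature.NumberTheory.GaloisRepresentations.IrreducibleOfIrreducibleReduction
import Literature.NumberTheory.GaloisRepresentations.OrdinaryGaloisRep
import Literature.NumberTheory.GaloisRepresentations.CalegariEvenFontaineMazurTwo
import Literature.NumberTheory.GaloisRepresentations.AbsolutelyIrreducibleReduction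
import Literature.NumberTheory.GaloisRepresentations.ResidualRepOfTraceCongruence
import Literature.NumberTheory.PAdicHodge.FontaineDpst
import Literature.NumberTheory.DiophantineGeometry.Conductor
import Literature.NumberTheory.DiophantineGeometry.LocalReduction
import Summits.ABC.ABC.Theorems.DefiniteXiFreyModularityStubNineTransfer
import HarnessLib

/-!
# Stub-ideation k = 1, GENERATION 13 (home family 1 = RECOGNISE & IMPORT) for `stub_liftThree`
# of crux `FreyModularity` (stmt-ABC-11340, route ABC/DefiniteXi, line `Lines/Sketch.lean`,
# sha 21576c53)

Companion of `STUB-IDEAS-stub_liftThree-1.md` (gen 13).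

**The move.**  `stub_liftThree` (= Diamond 1996 Thm. 5.3 / 5.4 at `ℓ = 3` ∩ `{9 ∤ N}`) and its twin
`stub_liftFive` are two instances of ONE `ℓ`-generic, CURVE-FREE theorem: Diamond, CSS XVII
**Cor. 6.2** (= Diamond 1996 Thm. 5.3 = DDT **Cor. 3.46** with "semistable at `ℓ`" in place of
"semistable"): *`ℓ` odd, `ρ̄` modular (weight 2, DDT Def. 3.12), `ρ̄|ℚ(√ℓ*)` absolutely irreducible,
`ρ : Γ_ℚ → GL₂(ℚ̄_ℓ)` a lift of `ρ̄` with cyclotomic determinant, unramified outside a finite set and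
SEMISTABLE AT `ℓ` (ordinary of weight `2`, or flat = crystalline with Hodge–Tate weights `[-1,0]`)
⇒ `ρ` is modular (weight 2, DDT Def. 3.16).*  This file TYPES that socket once, generically in `ℓ`
(`DiamondCSS62 ℓ`, W-free; conclusion directly in the tree's weight-2 attachment currency
`IsGaloisRepOfNewform1`), IMPORTS the adapters the sibling lanes already proved — k1-liftFive-g6's
OUT adapter (generic, PROVED), k2-liftFive-g11's RC / B1a / DET / UR (ported `5 ↦ ℓ`, PROVED here),
k3-liftFive-g10's ordinary-of-multiplicative lemma (PROVED there, generic; cited as a `Prop`),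
k3-liftThree-g11's crystalline-of-good-reduction fact H1 (named-fact shape; cited as a `Prop`), the
landed `Summit.ABC.ABC.Theorems.sq_dvd_conductorNorm_iff_hasAdditiveReductionAt` (semistable split)
— and PROVES the generic glue

  `modularityLifting_tate_of_socket : DiamondCSS62 ℓ → IN1 ℓ → OrdOfMult ℓ → CrysOfGood ℓ →
     ModularityLifting_tate ℓ`   (any prime `ℓ ≠ 2`),

whose instances are `stub_liftThree` (`ℓ = 3`: `liftThree_of_socket`) AND `stub_liftFive`
(`ℓ = 5`: `liftFive_of_socket`) VERBATIM.  So S1b and S2 of the skeleton share ONE fact-level debt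
(the `R_Σ = T_Σ` output, W-free) + the any-weight→weight-2 input adapter IN1 + one `p`-adic Hodge
fact, and nothing curve-specific is left unproved except the two cited `Prop`s whose proofs exist
(ORD) or are Literature-level (CRYS).

Kernel status of this file: NO `sorry`.  Helper STATEMENTS are `def … : Prop`; every `theorem` is
proved.
-/

noncomputable section

open scoped MatrixGroups Matrix NumberField ModularForm Polynomial Classical NNReal
open NumberField IsDedekindDomain IsDedekindDomain.HeightOneSpectrum Polynomial Filter
open Literature.NumberTheory Literature.NumberTheory.Automorphic Literature.NumberTheory.Automorphic.BCDT
open Literature.NumberTheory.GaloisRepresentations Literature.NumberTheory.GaloisRepresentations.ModPGaloisRep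
open Literature.NumberTheory.EllipticCurves Literature.NumberTheory.EllipticCurves.ModularForms
open Literature.NumberTheory.PAdicHodge
open CongruenceSubgroup Rat.HeightOneSpectrum WeierstrassCurve Field IsLocalRing
open Summit.ABC.ABC.Theorems

namespace Summit.ABC.ABC.Cruxes.FreyModularity.StubIdeas.LiftThree1g13

/-! ## §0 The two stubs, verbatim, and the generic frame (k1-liftFive-g6, verbatim) -/

/-- `stub_liftThree` of `Lines/Sketch.lean:157`, VERBATIM. [cite: Diamond1996, Thm. 5.3]
[cite: ConradDiamondTaylor1999, Thm. 7.2.1] -/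
def LiftThree : Prop :=
  ∀ (W : WeierstrassCurve ℚ) [W.IsElliptic] (ρ : ModPGaloisRep ℚ (ZMod 3) 2),
    W.IsTorsionGaloisRep 3 ρ → ρ.IsAbsIrreducibleOverSqrt (-3) → ¬ 9 ∣ W.conductorNorm ℤ →
    ρ.IsModular → W.IsModularGaloisRepTate 3

/-- `stub_liftFive` of `Lines/Sketch.lean`, VERBATIM. [cite: Diamond1996, Thm. 5.3] -/
def LiftFive : Prop :=
  ∀ (W : WeierstrassCurve ℚ) [W.IsElliptic] (ρ : ModPGaloisRep ℚ (ZMod 5) 2),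
    W.IsTorsionGaloisRep 5 ρ → ρ.IsAbsIrreducibleOverSqrt 5 → ¬ 25 ∣ W.conductorNorm ℤ →
    ρ.IsModular → W.IsModularGaloisRepTate 5

/-- `ℓ* = (-1)^{(ℓ-1)/2} ℓ` (Rubin CSS Thm. B / Diamond CSS XVII §1: `L = ℚ(√(εℓ))`). [folklore] -/
def pStar (p : ℕ) : ℚ := (-1) ^ ((p - 1) / 2) * p

theorem pStar_three : pStar 3 = -3 := by norm_num [pStar]

theorem pStar_five : pStar 5 = 5 := by norm_num [pStar]

/-- **The generic stub** (k1-liftFive-g6 `ModularityLifting_tate`, verbatim): `stub_liftThree` is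
its `ℓ = 3` instance, `stub_liftFive` its `ℓ = 5` instance (`liftThree_iff`, `liftFive_iff`).
[cite: Diamond1996, Thm. 5.3] -/
def ModularityLifting_tate (p : ℕ) [Fact p.Prime] : Prop :=
  ∀ (W : WeierstrassCurve ℚ) [W.IsElliptic] (ρ : ModPGaloisRep ℚ (ZMod p) 2),
    W.IsTorsionGaloisRep p ρ → ρ.IsAbsIrreducibleOverSqrt (pStar p) →
    ¬ p ^ 2 ∣ W.conductorNorm ℤ → ρ.IsModular → W.IsModularGaloisRepTate p

/-- (PROVED) RECOGNISE: `stub_liftThree` IS `ModularityLifting_tate 3`. [folklore] -/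
theorem liftThree_iff : LiftThree ↔ (haveI : Fact (Nat.Prime 3) := ⟨Nat.prime_three⟩;
    ModularityLifting_tate 3) := by
  haveI : Fact (Nat.Prime 3) := ⟨Nat.prime_three⟩
  have h9 : (3 : ℕ) ^ 2 = 9 := by norm_num
  constructor
  · intro h W _ ρ hρ hirr hN hmod
    rw [pStar_three] at hirr
    rw [h9] at hN
    exact h W ρ hρ hirr hN hmod
  · intro h W _ ρ hρ hirr hN hmod
    refine h W ρ hρ ?_ ?_ hmod
    · rw [pStar_three]; exact hirr
    · rw [h9]; exact hN

/-- (PROVED) RECOGNISE: `stub_liftFive` IS `ModularityLifting_tate 5`. [folklore] -/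
theorem liftFive_iff : LiftFive ↔ (haveI : Fact (Nat.Prime 5) := ⟨Nat.prime_five⟩;
    ModularityLifting_tate 5) := by
  haveI : Fact (Nat.Prime 5) := ⟨Nat.prime_five⟩
  have h25 : (5 : ℕ) ^ 2 = 25 := by norm_num
  constructor
  · intro h W _ ρ hρ hirr hN hmod
    rw [pStar_five] at hirr
    rw [h25] at hN
    exact h W ρ hρ hirr hN hmod
  · intro h W _ ρ hρ hirr hN hmod
    refine h W ρ hρ ?_ ?_ hmod
    · rw [pStar_five]; exact hirr
    · rw [h25]; exact hN

/-- **"`ρ_{E,ℓ}` is modular" (DDT Def. 3.16)** on the tree's framed `ℓ`-adic representation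
(k1-liftFive-g6 `IsFramedModularTate`, verbatim). [cite: DarmonDiamondTaylor1995, Def. 3.16 (p. 91)] -/
def IsFramedModularTate (W : WeierstrassCurve ℚ) [W.IsElliptic] (p : ℕ) [Fact p.Prime] : Prop :=
  ∃ (M : ℕ) (_ : NeZero M) (g : CuspForm (Gamma1 M) 2) (ι : coeffCharField g →+* PadicAlgCl p),
    IsNewform1 g ∧ IsGaloisRepOfNewform1 g ι {r | r ∣ M * p} (W.framedTateGaloisRep p)

/-- **OUT adapter** (k1-liftFive-g6 H1, verbatim): DDT-modular (framed, weight 2) ⇒ BCDT (4). -/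
def OutAdapter (p : ℕ) [Fact p.Prime] : Prop :=
  ∀ (W : WeierstrassCurve ℚ) [W.IsElliptic], IsFramedModularTate W p → W.IsModularGaloisRepTate p

/-- **DDT Def. 3.12 — `ρ̄` modular of WEIGHT 2** (k1-liftFive-g6, verbatim): the `w = 2` slice of
the tree's any-weight `ModPGaloisRep.IsModular`. [cite: DarmonDiamondTaylor1995, Def. 3.12 (p. 89)] -/
def IsModularWeightTwo {k : Type} [Field k] [TopologicalSpace k] [DiscreteTopology k]
    (ρ : ModPGaloisRep ℚ k 2) : Prop :=
  ∃ (N : ℕ) (_ : NeZero N) (f : CuspForm (Gamma1 N) 2) (K : Type) (_ : Field K)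
    (_ : TopologicalSpace K) (_ : DiscreteTopology K) (j : k →+* K)
    (ι : coeffCharIntegers f →+* K),
    IsNewform1 f ∧
      IsGaloisRepOfNewform1Int f ι {q | q ∣ N * ringChar k}
        (FramedRep.baseChange j continuous_of_discreteTopology ρ)

/-- Weight-2 modular ⇒ BCDT-modular (forgetful; k1-liftFive-g6, verbatim). [folklore] -/
theorem isModular_of_isModularWeightTwo {k : Type} [Field k] [TopologicalSpace k]
    [DiscreteTopology k] {ρ : ModPGaloisRep ℚ k 2} (h : IsModularWeightTwo ρ) : ρ.IsModular := by
  obtain ⟨N, hN, f, K, hK, hT, hD, j, ι, hf, hatt⟩ := h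
  exact ⟨N, hN, 2, f, K, hK, hT, hD, j, ι, by norm_num, hf, hatt⟩

/-- **IN1 (input adapter, named-fact size; k1-liftFive-g6, verbatim)**: for absolutely irreducible
`ρ̄`, BCDT-modular of ANY weight ⇒ modular of weight 2 (Ash–Stevens 1986 Thm. 3.5 for weights `≥ 2`;
for the weight-1 witness of `stub_modThree`: Wiles' `f · E ≡ f (mod 3)` + Deligne–Serre 6.11 — in the
tree: `DeligneSerre1974.exists_eigenform_congr_of_weight_one`,
`exists_ordinary_newform_congr_of_weight_one`). [cite: AshStevens1986, Thm. 3.5]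
[cite: DeligneSerreASENS1974, 6.9–6.11] [cite: Wiles1995, Ch. 5 (p. 544)] -/
def IN1 (p : ℕ) [Fact p.Prime] : Prop :=
  ∀ ρ : ModPGaloisRep ℚ (ZMod p) 2, FramedRep.IsAbsolutelyIrreducible ρ → ρ.IsModular →
    IsModularWeightTwo ρ

/-! ## §1 THE SOCKET — Diamond CSS XVII Cor. 6.2 / DDT Cor. 3.46, W-free, `ℓ`-generic -/

/-- `ρ̄ ⊗ 𝔽̄_ℓ`: the mod-`ℓ` representation pushed into the residue field `ℤ̄_ℓ/𝔪` of `ℚ̄_ℓ` along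
`𝔽_ℓ → ℤ̄_ℓ/𝔪` (`zmodToPadicAlgClResidueField`, in the tree; k2-liftFive-g11 `residualModFive`
made generic). [folklore] -/
def residualMod (ℓ : ℕ) [Fact ℓ.Prime] (ρ : ModPGaloisRep ℚ (ZMod ℓ) 2) :
    absoluteGaloisGroup ℚ →* GL (Fin 2) (padicAlgClResidueField ℓ) :=
  (Matrix.GeneralLinearGroup.map (zmodToPadicAlgClResidueField ℓ)).comp
    (ρ : absoluteGaloisGroup ℚ →* GL (Fin 2) (ZMod ℓ))

/-- **"Semistable at `ℓ` in the sense of [DDT, §2.4]"** for a framed `τ : Γ_ℚ → GL₂(ℚ̄_ℓ)` with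
cyclotomic determinant, at a place `v ∣ ℓ`: ORDINARY of weight 2 (`(χ_ℓ ψ₁ ∗; 0 ψ₂)`, `ψᵢ|I_v = 1`,
the tree's `IsOrdinaryOfWeightAt ℓ τ v 2 1`) OR FLAT, typed as CRYSTALLINE with Hodge–Tate weights
in `[-1, 0]` for the tree's datum `fontainePstAdicCompletion v ℓ hv` (Raynaud / Breuil–Kisin, `ℓ > 2`:
flat ⟺ crystalline `[0,1]`; tree weight convention `HT(χ_ℓ) = -1`).
[cite: DarmonDiamondTaylor1995, §2.4] [cite: Kisin2007, Cor. 2.7.7] [cite: SkinnerWiles1999, §1 Theorem (ii)] -/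
def IsSemistableAtEll (ℓ : ℕ) [Fact ℓ.Prime] (τ : FramedGaloisRep ℚ (PadicAlgCl ℓ) 2)
    (v : HeightOneSpectrum (𝓞 ℚ)) (hv : ((ℓ : ℕ) : 𝓞 ℚ) ∈ v.asIdeal) : Prop :=
  FramedGaloisRep.IsOrdinaryOfWeightAt ℓ τ v 2 1 ∨
    ((fontainePstAdicCompletion v ℓ hv).IsCrystallineFramed (τ.toLocal v) ∧
      (fontainePstAdicCompletion v ℓ hv).IsDeRhamWithWeightsIn (-1) 0 (τ.toLocal v))

/-- **THE SOCKET `DiamondCSS62 ℓ` (W-FREE, `ℓ`-GENERIC; named-fact size = the `R_Σ = T_Σ` output).**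
Diamond, CSS ch. XVII Cor. 6.2 (with Thm. 6.1 and §4 "type Σ") = Diamond 1996 Thm. 5.3 = DDT Cor. 3.46
with "semistable" weakened to "semistable at `ℓ`", specialised to cyclotomic determinant: for an odd
prime `ℓ`, a `ρ̄ : Γ_ℚ → GL₂(𝔽_ℓ)` MODULAR OF WEIGHT 2 and absolutely irreducible on `Γ_{ℚ(√ℓ*)}`, every
continuous `τ : Γ_ℚ → GL₂(ℚ̄_ℓ)` (a) whose residual characteristic polynomials are those of `ρ̄ ⊗ 𝔽̄_ℓ`,
(b) with `det τ = χ_ℓ`, (c) unramified outside a finite set of primes, (d) semistable at `ℓ`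
(`IsSemistableAtEll`), IS MODULAR: `τ ≅ ρ_{g,ι}` for a weight-2 newform `g` (`IsGaloisRepOfNewform1`).
No curve in sight; `ℓ = 3` feeds `stub_liftThree`, `ℓ = 5` feeds `stub_liftFive`.
[cite: Diamond1997CSS, Cor. 6.2 (p. 571), Thm. 6.1, §4 (p. 570)] [cite: Diamond1996, Thm. 5.3]
[cite: DarmonDiamondTaylor1995, Cor. 3.46 (p. 102), Def. 3.12, Def. 3.16, §2.4] -/
def DiamondCSS62 (ℓ : ℕ) [Fact ℓ.Prime] : Prop :=
  ∀ (ρ : ModPGaloisRep ℚ (ZMod ℓ) 2) (τ : FramedGaloisRep ℚ (PadicAlgCl ℓ) 2),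
    ℓ ≠ 2 → IsModularWeightTwo ρ → ρ.IsAbsIrreducibleOverSqrt (pStar ℓ) →
    HasResidualCharpolys (RingHom.id (padicAlgClResidueField ℓ))
      (τ : absoluteGaloisGroup ℚ →* GL (Fin 2) (PadicAlgCl ℓ)) (residualMod ℓ ρ) →
    (∀ σ : absoluteGaloisGroup ℚ,
      ((τ σ : GL (Fin 2) (PadicAlgCl ℓ)) : Matrix (Fin 2) (Fin 2) (PadicAlgCl ℓ)).det =
        algebraMap ℚ_[ℓ] (PadicAlgCl ℓ) (PadicInt.Coe.ringHom (p := ℓ)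
          ((GaloisRep.cyclotomicCharacter ℚ ℓ σ : ℤ_[ℓ]ˣ) : ℤ_[ℓ]))) →
    (∃ S : Set ℕ, S.Finite ∧ ∀ v : HeightOneSpectrum (𝓞 ℚ),
      ((primesEquiv v : Nat.Primes) : ℕ) ∉ S → τ.IsUnramifiedAt v) →
    (∀ (v : HeightOneSpectrum (𝓞 ℚ)) (hv : ((ℓ : ℕ) : 𝓞 ℚ) ∈ v.asIdeal), IsSemistableAtEll ℓ τ v hv) →
    ∃ (M : ℕ) (_ : NeZero M) (g : CuspForm (Gamma1 M) 2) (ι : coeffCharField g →+* PadicAlgCl ℓ),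
      IsNewform1 g ∧ IsGaloisRepOfNewform1 g ι {r | r ∣ M * ℓ} τ

/-! ## §2 Curve-side local providers at `v ∣ ℓ` (cited `Prop`s: proofs live in sibling lanes) -/

/-- **ORD `OrdOfMult ℓ`** — multiplicative reduction at `v ∣ ℓ` ⇒ `ρ_{W,ℓ}` ordinary of weight 2 at `v`
(Tate curve, `(χ_ℓ ∗; 0 1)` on inertia).  **PROVED, generically in the prime and the number field, by
k3-liftFive-g10** (`isOrdinaryOfWeightAt_framedTateGaloisRep_of_hasMultiplicativeReductionAt`,
`STUB_IDEAS_stub_liftFive_3g10.lean`, 0 sorries) — cited as a `Prop` since crux workfiles do not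
import one another; to be landed `--supports stmt-ABC-11340 --as helper`.
[cite: SilvermanATAEC1994, V §5 Thm. 5.3] [cite: SkinnerWiles1999, §1 Theorem (ii)] -/
def OrdOfMult (ℓ : ℕ) [Fact ℓ.Prime] : Prop :=
  ∀ (W : WeierstrassCurve ℚ) [W.IsElliptic] (v : HeightOneSpectrum (𝓞 ℚ)),
    ((ℓ : ℕ) : 𝓞 ℚ) ∈ v.asIdeal → W.HasMultiplicativeReductionAt v →
    FramedGaloisRep.IsOrdinaryOfWeightAt ℓ (W.framedTateGaloisRep ℓ) v 2 1

/-- **CRYS `CrysOfGood ℓ`** — good reduction at `v ∣ ℓ` ⇒ `ρ_{W,ℓ}|Γ_{ℚ_v}` crystalline with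
Hodge–Tate weights in `[-1,0]` for THE datum (k3-liftThree-g11 H1
`isCrystallineFramed_toLocal_framedTateGaloisRep_of_hasGoodReductionAt`, named-fact shape, restricted
to `K = ℚ`).  [cite: Conrad1997Flat, Thm. 1.2] [cite: Faltings1989Crystalline, §5] [cite: Tsuji1999Cst, Thm. 0.2] -/
def CrysOfGood (ℓ : ℕ) [Fact ℓ.Prime] : Prop :=
  ∀ (W : WeierstrassCurve ℚ) [W.IsElliptic] (v : HeightOneSpectrum (𝓞 ℚ))
    (hv : ((ℓ : ℕ) : 𝓞 ℚ) ∈ v.asIdeal), W.HasGoodReductionAt v →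
    (fontainePstAdicCompletion v ℓ hv).IsCrystallineFramed ((W.framedTateGaloisRep ℓ).toLocal v) ∧
      (fontainePstAdicCompletion v ℓ hv).IsDeRhamWithWeightsIn (-1) 0
        ((W.framedTateGaloisRep ℓ).toLocal v)

/-! ## §3 The adapters, ported `5 ↦ ℓ` from k2-liftFive-g11 / k1-liftFive-g6 and PROVED -/

section Adapters

variable (ℓ : ℕ) [hℓ : Fact ℓ.Prime]

/-- `p_v ≠ ℓ ⇒ ℓ ∉ v` for a finite place `v` of `ℚ`. [folklore] -/
theorem ell_not_mem_asIdeal_of_ne (v : HeightOneSpectrum (𝓞 ℚ))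
    (hv : ((primesEquiv v : Nat.Primes) : ℕ) ≠ ℓ) : ((ℓ : ℕ) : 𝓞 ℚ) ∉ v.asIdeal := by
  intro h
  apply hv
  change natGenerator v = ℓ
  rw [← Nat.prime_dvd_prime_iff_eq (prime_natGenerator v) hℓ.out, natGenerator_dvd_iff,
    ← map_natCast (Rat.IsIntegralClosure.intEquiv (𝓞 ℚ)) ℓ, Ideal.apply_mem_of_equiv_iff]
  exact h

/-- `ℓ ∈ v ⇒ p_v = ℓ`. [folklore] -/
theorem primesEquiv_eq_of_mem (v : HeightOneSpectrum (𝓞 ℚ))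
    (hv : ((ℓ : ℕ) : 𝓞 ℚ) ∈ v.asIdeal) : ((primesEquiv v : Nat.Primes) : ℕ) = ℓ := by
  by_contra h
  exact ell_not_mem_asIdeal_of_ne ℓ v h hv

/-- (PROVED) **UR**: `p_v ∤ N_W`, `p_v ≠ ℓ` ⇒ `ρ_{W,ℓ}` unramified at `v` (`dvd_conductorNorm_iff` +
Néron–Ogg–Shafarevich, easy direction). [cite: SilvermanAEC2009, Prop. VII.4.1(b)] -/
theorem isUnramifiedAt_of_not_dvd_conductorNorm (W : WeierstrassCurve ℚ) [W.IsElliptic]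
    (v : HeightOneSpectrum (𝓞 ℚ)) (hN : ¬ ((primesEquiv v : Nat.Primes) : ℕ) ∣ W.conductorNorm ℤ)
    (hv : ((primesEquiv v : Nat.Primes) : ℕ) ≠ ℓ) : (W.framedTateGaloisRep ℓ).IsUnramifiedAt v := by
  have hgood : W.HasGoodReductionAt v := by
    by_contra h
    exact hN ((W.dvd_conductorNorm_iff v).mpr h)
  exact W.isUnramifiedAt_framedTateGaloisRep ℓ hgood (ell_not_mem_asIdeal_of_ne ℓ v hv)

/-- (PROVED) **UR-fin**: `ρ_{W,ℓ}` is unramified outside the FINITE set `{q : q ∣ N_W} ∪ {ℓ}`. [folklore] -/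
theorem exists_finite_isUnramifiedAt (W : WeierstrassCurve ℚ) [W.IsElliptic] :
    ∃ S : Set ℕ, S.Finite ∧ ∀ v : HeightOneSpectrum (𝓞 ℚ),
      ((primesEquiv v : Nat.Primes) : ℕ) ∉ S → (W.framedTateGaloisRep ℓ).IsUnramifiedAt v := by
  refine ⟨{q | q ∣ W.conductorNorm ℤ} ∪ {ℓ}, ?_, fun v hv => ?_⟩
  · refine Set.Finite.union ?_ (Set.finite_singleton ℓ)
    exact (Nat.divisors (W.conductorNorm ℤ)).finite_toSet.subset fun q hq =>
      by simpa [Nat.mem_divisors, (conductorNorm_pos_holds W).ne'] using hq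
  · simp only [Set.mem_union, Set.mem_setOf_eq, Set.mem_singleton_iff, not_or] at hv
    exact isUnramifiedAt_of_not_dvd_conductorNorm ℓ W v hv.1 hv.2

/-- **H1b** (k1-liftFive-g6, generic, PROVED, verbatim): the characteristic polynomial of the framed
`ρ_{E,ℓ}(σ)` is `charpoly(σ | T_ℓ E)` pushed along `ℤ_ℓ → ℚ_ℓ → ℚ̄_ℓ`. [folklore] -/
theorem charpoly_framedTateGaloisRep_eq_map_map (W : WeierstrassCurve ℚ) [W.IsElliptic]
    (σ : absoluteGaloisGroup ℚ) :
    haveI := module_free_tateModule_holds W ℓ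
    haveI := module_finite_tateModule_holds W ℓ
    FramedRep.charpoly (W.framedTateGaloisRep ℓ) σ =
      ((W.galoisRepTate ℓ σ).charpoly.map (PadicInt.Coe.ringHom (p := ℓ))).map
        (algebraMap ℚ_[ℓ] (PadicAlgCl ℓ)) := by
  haveI := module_free_tateModule_holds W ℓ
  haveI := module_finite_tateModule_holds W ℓ
  rw [W.charpoly_framedTateGaloisRep_apply ℓ σ]
  congr 1
  have hc : (algebraMap ℤ_[ℓ] ℚ_[ℓ] : ℤ_[ℓ] →+* ℚ_[ℓ]) = PadicInt.Coe.ringHom := RingHom.ext fun _ => rfl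
  rw [← hc]
  exact LinearMap.charpoly_baseChange (W.galoisRepTate ℓ σ) ℚ_[ℓ]

/-- (PROVED) **DET**: `det ρ_{W,ℓ}(σ) = χ_ℓ(σ)` in `ℚ̄_ℓ` (k2-liftFive-g9/g11, ported `5 ↦ ℓ`).
[cite: SilvermanAEC2009, III.8.3] -/
theorem det_framedTateGaloisRep_eq_cyclotomic (W : WeierstrassCurve ℚ) [W.IsElliptic]
    (σ : absoluteGaloisGroup ℚ) :
    ((W.framedTateGaloisRep ℓ σ : GL (Fin 2) (PadicAlgCl ℓ)) : Matrix (Fin 2) (Fin 2) (PadicAlgCl ℓ)).det =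
      algebraMap ℚ_[ℓ] (PadicAlgCl ℓ) (PadicInt.Coe.ringHom (p := ℓ)
        ((GaloisRep.cyclotomicCharacter ℚ ℓ σ : ℤ_[ℓ]ˣ) : ℤ_[ℓ])) := by
  have hℓ0 : ((ℓ : ℕ) : ℚ) ≠ 0 := Nat.cast_ne_zero.mpr hℓ.out.ne_zero
  haveI := module_free_tateModule_holds W ℓ
  haveI := module_finite_tateModule_holds W ℓ
  rw [Matrix.det_eq_sign_charpoly_coeff]
  have hc : ((W.framedTateGaloisRep ℓ σ : GL (Fin 2) (PadicAlgCl ℓ)) :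
      Matrix (Fin 2) (Fin 2) (PadicAlgCl ℓ)).charpoly = FramedRep.charpoly (W.framedTateGaloisRep ℓ) σ := rfl
  rw [hc, charpoly_framedTateGaloisRep_eq_map_map ℓ W σ, Polynomial.coeff_map, Polynomial.coeff_map,
    Fintype.card_fin]
  have hdet := LinearMap.det_eq_sign_charpoly_coeff (W.galoisRepTate ℓ σ)
  rw [finrank_tateModule_eq_two_holds W ℓ hℓ0] at hdet
  rw [← W.det_galoisRepTate_eq_cyclotomicCharacter_holds ℓ hℓ0 σ, hdet]
  norm_num

/-- **The ring map `ℤ_ℓ → ℤ̄_ℓ`** over `ℚ_ℓ → ℚ̄_ℓ` (k2-liftFive-g11 B1a witness, ported). [folklore] -/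
def padicIntToAlgClIntegers : ℤ_[ℓ] →+* padicAlgClIntegers ℓ :=
  ((algebraMap ℚ_[ℓ] (PadicAlgCl ℓ)).comp (PadicInt.Coe.ringHom (p := ℓ))).codRestrict
    (padicAlgClIntegers ℓ) fun x => by
      rw [padicAlgCl_mem_valuationSubring_iff]
      change ‖((x : ℚ_[ℓ]) : PadicAlgCl ℓ)‖ ≤ 1
      rw [PadicAlgCl.norm_extends, ← PadicInt.norm_def]
      exact PadicInt.norm_le_one x

/-- Unfolding lemma for `padicIntToAlgClIntegers`. [folklore] -/
@[simp] theorem coe_padicIntToAlgClIntegers (x : ℤ_[ℓ]) :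
    ((padicIntToAlgClIntegers ℓ x : padicAlgClIntegers ℓ) : PadicAlgCl ℓ) =
      algebraMap ℚ_[ℓ] (PadicAlgCl ℓ) (x : ℚ_[ℓ]) := rfl

/-- (PROVED) **B1a**: `ℤ_ℓ → ℤ̄_ℓ` reduces to `x ↦ x mod ℓ` (k2-liftFive-g11, ported). [folklore] -/
theorem residue_padicIntToAlgClIntegers (x : ℤ_[ℓ]) :
    residue (padicAlgClIntegers ℓ) (padicIntToAlgClIntegers ℓ x) =
      ((PadicInt.toZMod (p := ℓ) x).val : padicAlgClResidueField ℓ) := by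
  rw [← map_natCast (residue (padicAlgClIntegers ℓ)) (PadicInt.toZMod (p := ℓ) x).val]
  apply residue_eq_of_norm_sub_lt_one
  have hmem := PadicInt.toZMod_spec x
  rw [IsLocalRing.mem_maximalIdeal, PadicInt.mem_nonunits, ZMod.cast_eq_val] at hmem
  rw [← map_natCast (padicIntToAlgClIntegers ℓ) (PadicInt.toZMod (p := ℓ) x).val,
    ← AddSubgroupClass.coe_sub, ← map_sub, coe_padicIntToAlgClIntegers]
  change ‖(((x - ((PadicInt.toZMod (p := ℓ) x).val : ℤ_[ℓ]) : ℤ_[ℓ]) : ℚ_[ℓ]) : PadicAlgCl ℓ)‖ < 1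
  rw [PadicAlgCl.norm_extends, ← PadicInt.norm_def]
  exact hmem

/-- (PROVED) **RC**: `ρ̄ ≅ W[ℓ]` gives the residual characteristic polynomials of `ρ_{W,ℓ}` relative
to `ρ̄ ⊗ 𝔽̄_ℓ` (k2-liftFive-g11 `residualCharpolysOfTorsionFive_holds`, ported `5 ↦ ℓ`):
`P_σ := charpoly(σ | T_ℓ W) ∈ ℤ_ℓ[X]` pushed to `ℤ̄_ℓ[X]`. [cite: DarmonDiamondTaylor1995, §2.1] -/
theorem hasResidualCharpolys_of_isTorsionGaloisRep (W : WeierstrassCurve ℚ) [W.IsElliptic]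
    (ρ : ModPGaloisRep ℚ (ZMod ℓ) 2) (hρ : W.IsTorsionGaloisRep ℓ ρ) :
    HasResidualCharpolys (RingHom.id (padicAlgClResidueField ℓ))
      (W.framedTateGaloisRep ℓ : absoluteGaloisGroup ℚ →* GL (Fin 2) (PadicAlgCl ℓ)) (residualMod ℓ ρ) := by
  intro σ
  haveI := module_free_tateModule_holds W ℓ
  haveI := module_finite_tateModule_holds W ℓ
  have hℓ0 : ((ℓ : ℕ) : ℚ) ≠ 0 := Nat.cast_ne_zero.mpr hℓ.out.ne_zero
  have hf : (padicAlgClIntegers ℓ).subtype.comp (padicIntToAlgClIntegers ℓ) =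
      (algebraMap ℚ_[ℓ] (PadicAlgCl ℓ)).comp (PadicInt.Coe.ringHom (p := ℓ)) := RingHom.ext fun x => rfl
  refine ⟨((W.galoisRepTate ℓ σ).charpoly).map (padicIntToAlgClIntegers ℓ), ?_, ?_⟩
  · rw [Polynomial.map_map, hf, ← Polynomial.map_map]
    exact (charpoly_framedTateGaloisRep_eq_map_map ℓ W σ).symm
  · have hR : ((residualMod ℓ ρ σ : GL (Fin 2) (padicAlgClResidueField ℓ)) :
        Matrix (Fin 2) (Fin 2) (padicAlgClResidueField ℓ)).charpoly =
        (((ρ σ : GL (Fin 2) (ZMod ℓ)) : Matrix (Fin 2) (Fin 2) (ZMod ℓ)).charpoly).map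
          (zmodToPadicAlgClResidueField ℓ) := by
      rw [← Matrix.charpoly_map]
      rfl
    rw [Polynomial.map_map, hR, hρ.charpoly_eq_map_charpoly_galoisRepTate W ℓ hℓ0 σ, Polynomial.map_map]
    congr 1
    refine RingHom.ext fun x => ?_
    rw [RingHom.comp_apply, RingHom.comp_apply, RingHom.id_apply, residue_padicIntToAlgClIntegers ℓ x,
      RingHom.comp_apply]
    conv_rhs => rw [← ZMod.natCast_zmod_val (PadicInt.toZMod (p := ℓ) x)]
    rw [map_natCast]

/-- **H1a** (k1-liftFive-g6, generic, PROVED, verbatim): framed `ρ_{E,ℓ}` unramified at `v` ⇒ inertia at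
`v` acts trivially on `T_ℓ E`. [folklore] -/
theorem galoisRepTate_eq_one_of_isUnramifiedAt (W : WeierstrassCurve ℚ) [W.IsElliptic]
    {v : HeightOneSpectrum (𝓞 ℚ)} (h : (W.framedTateGaloisRep ℓ).IsUnramifiedAt v) :
    ∀ 𝔓 ∈ v.primesAbove, ∀ σ ∈ 𝔓.inertia (absoluteGaloisGroup ℚ), W.galoisRepTate ℓ σ = 1 := by
  intro 𝔓 h𝔓 σ hσ
  have h1 := ((W.isUnramifiedAt_framedTateGaloisRep_iff ℓ
    (W.continuous_rationalGaloisRepTate_holds ℓ) v).mp h) 𝔓 h𝔓 σ hσ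
  exact W.galoisRepTate_eq_one_of_rationalGaloisRepTate_eq_one ℓ h1

/-- (PROVED) **OUT adapter** (k1-liftFive-g6 `outAdapter_holds`, generic, verbatim): DDT-modular framed
weight 2 ⇒ `IsModularGaloisRepTate`. [folklore] -/
theorem outAdapter_holds : OutAdapter ℓ := by
  intro W _ h
  obtain ⟨M, hM, g, ι, hg, hatt⟩ := h
  haveI := module_free_tateModule_holds W ℓ
  haveI := module_finite_tateModule_holds W ℓ
  refine ⟨M, hM, 2, g, PadicAlgCl ℓ, inferInstance, inferInstance, ι, by norm_num, hg, ?_⟩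
  intro v hv 𝔓 h𝔓
  obtain ⟨hur, hchar⟩ := hatt v hv
  refine ⟨galoisRepTate_eq_one_of_isUnramifiedAt ℓ W hur 𝔓 h𝔓, fun σ hσ => ?_⟩
  have hc := hchar 𝔓 h𝔓 σ hσ
  rw [charpoly_framedTateGaloisRep_eq_map_map ℓ W σ] at hc
  rw [← Polynomial.map_map, ← W.map_charpoly_galoisRepTate_eq ℓ (PadicInt.Coe.ringHom (p := ℓ)) σ]
  exact hc

/-- (PROVED) **SEMISTABLE SPLIT at `v ∣ ℓ`**: `ℓ² ∤ N_W` ⇒ good or multiplicative reduction at the place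
over `ℓ` (landed `sq_dvd_conductorNorm_iff_hasAdditiveReductionAt` + the local trichotomy).
[cite: SilvermanATAEC1994, Thm. IV.10.2(a)] -/
theorem good_or_mult_of_not_sq_dvd (W : WeierstrassCurve ℚ) [W.IsElliptic]
    (hN : ¬ ℓ ^ 2 ∣ W.conductorNorm ℤ) (v : HeightOneSpectrum (𝓞 ℚ))
    (hv : ((ℓ : ℕ) : 𝓞 ℚ) ∈ v.asIdeal) :
    W.HasGoodReductionAt v ∨ W.HasMultiplicativeReductionAt v := by
  have hadd : ¬ W.HasAdditiveReductionAt v := fun h =>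
    hN ((sq_dvd_conductorNorm_iff_hasAdditiveReductionAt W hℓ.out (primesEquiv_eq_of_mem ℓ v hv)).mpr h)
  exact (isSemistableAt_iff_not_hasAdditiveReductionAt v W).mpr hadd

/-- (PROVED) **LOCAL**: `ℓ² ∤ N_W` + ORD + CRYS ⇒ `ρ_{W,ℓ}` semistable at every `v ∣ ℓ` in DDT's sense. -/
theorem isSemistableAtEll_framedTateGaloisRep (hO : OrdOfMult ℓ) (hC : CrysOfGood ℓ)
    (W : WeierstrassCurve ℚ) [W.IsElliptic] (hN : ¬ ℓ ^ 2 ∣ W.conductorNorm ℤ)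
    (v : HeightOneSpectrum (𝓞 ℚ)) (hv : ((ℓ : ℕ) : 𝓞 ℚ) ∈ v.asIdeal) :
    IsSemistableAtEll ℓ (W.framedTateGaloisRep ℓ) v hv := by
  rcases good_or_mult_of_not_sq_dvd ℓ W hN v hv with hg | hm
  · exact Or.inr (hC W v hv hg)
  · exact Or.inl (hO W v hv hm)

end Adapters

/-! ## §4 THE GLUE (PROVED): socket + IN1 + ORD + CRYS ⇒ the generic stub ⇒ both registered stubs -/

/-- (PROVED) **`ModularityLifting_tate ℓ ⟸ DiamondCSS62 ℓ + IN1 ℓ + OrdOfMult ℓ + CrysOfGood ℓ`**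
for every prime `ℓ ≠ 2`: instantiate the socket at `τ := ρ_{W,ℓ}` — (a) is RC, (b) is DET, (c) is
UR-fin, (d) is LOCAL; the weight-2 input is IN1 applied to the stub's any-weight `ρ̄.IsModular`
(absolute irreducibility from `IsAbsIrreducibleOverSqrt.isAbsolutelyIrreducible`, in the tree); the
exit is the OUT adapter. -/
theorem modularityLifting_tate_of_socket (ℓ : ℕ) [Fact ℓ.Prime] (hℓ2 : ℓ ≠ 2)
    (hX : DiamondCSS62 ℓ) (hIN : IN1 ℓ) (hO : OrdOfMult ℓ) (hC : CrysOfGood ℓ) :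
    ModularityLifting_tate ℓ := by
  intro W _ ρ hρ hirr hN hmod
  refine outAdapter_holds ℓ W ?_
  exact hX ρ (W.framedTateGaloisRep ℓ) hℓ2 (hIN ρ hirr.isAbsolutelyIrreducible hmod) hirr
    (hasResidualCharpolys_of_isTorsionGaloisRep ℓ W ρ hρ) (det_framedTateGaloisRep_eq_cyclotomic ℓ W)
    (exists_finite_isUnramifiedAt ℓ W)
    (fun v hv => isSemistableAtEll_framedTateGaloisRep ℓ hO hC W hN v hv)

/-- (PROVED) **`stub_liftThree` ⟸ socket at `3` + IN1₃ + ORD₃ + CRYS₃.** [cite: Diamond1996, Thm. 5.3] -/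
theorem liftThree_of_socket :
    (haveI : Fact (Nat.Prime 3) := ⟨Nat.prime_three⟩;
      DiamondCSS62 3 → IN1 3 → OrdOfMult 3 → CrysOfGood 3 → LiftThree) := by
  haveI : Fact (Nat.Prime 3) := ⟨Nat.prime_three⟩
  intro hX hIN hO hC
  exact liftThree_iff.mpr (modularityLifting_tate_of_socket 3 (by norm_num) hX hIN hO hC)

/-- (PROVED) **`stub_liftFive` ⟸ THE SAME socket at `5` + IN1₅ + ORD₅ + CRYS₅** — one socket serves
S1b and S2. [cite: Diamond1996, Thm. 5.3] -/
theorem liftFive_of_socket :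
    (haveI : Fact (Nat.Prime 5) := ⟨Nat.prime_five⟩;
      DiamondCSS62 5 → IN1 5 → OrdOfMult 5 → CrysOfGood 5 → LiftFive) := by
  haveI : Fact (Nat.Prime 5) := ⟨Nat.prime_five⟩
  intro hX hIN hO hC
  exact liftFive_iff.mpr (modularityLifting_tate_of_socket 5 (by norm_num) hX hIN hO hC)

/-! ## §5 Sanity: the socket's hypotheses are NOT vacuous / degenerate on the consumer -/

/-- (PROVED) On the Frey instance the socket is fed a GENUINE datum in each slot: RC, DET and UR-fin
hold for every elliptic `W` unconditionally (so the socket's (a)–(c) never filter out the consumer),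
and the local clause is exactly the stub's `ℓ² ∤ N` read through ORD/CRYS. [folklore] -/
theorem socket_inputs_available (ℓ : ℕ) [Fact ℓ.Prime] (W : WeierstrassCurve ℚ) [W.IsElliptic]
    (ρ : ModPGaloisRep ℚ (ZMod ℓ) 2) (hρ : W.IsTorsionGaloisRep ℓ ρ) :
    HasResidualCharpolys (RingHom.id (padicAlgClResidueField ℓ))
        (W.framedTateGaloisRep ℓ : absoluteGaloisGroup ℚ →* GL (Fin 2) (PadicAlgCl ℓ)) (residualMod ℓ ρ) ∧
      (∀ σ : absoluteGaloisGroup ℚ,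
        ((W.framedTateGaloisRep ℓ σ : GL (Fin 2) (PadicAlgCl ℓ)) :
            Matrix (Fin 2) (Fin 2) (PadicAlgCl ℓ)).det =
          algebraMap ℚ_[ℓ] (PadicAlgCl ℓ) (PadicInt.Coe.ringHom (p := ℓ)
            ((GaloisRep.cyclotomicCharacter ℚ ℓ σ : ℤ_[ℓ]ˣ) : ℤ_[ℓ]))) ∧
      ∃ S : Set ℕ, S.Finite ∧ ∀ v : HeightOneSpectrum (𝓞 ℚ),
        ((primesEquiv v : Nat.Primes) : ℕ) ∉ S → (W.framedTateGaloisRep ℓ).IsUnramifiedAt v :=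
  ⟨hasResidualCharpolys_of_isTorsionGaloisRep ℓ W ρ hρ, det_framedTateGaloisRep_eq_cyclotomic ℓ W,
    exists_finite_isUnramifiedAt ℓ W⟩

end Summit.ABC.ABC.Cruxes.FreyModularity.StubIdeas.LiftThree1g13
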